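import Summits.RiemannHypothesis.RiemannHypothesis.Theorems.JensenPolynomialsXiGorttwCoeffSmallTableCheck

/-!
# Route `JensenPolynomials`, item `XiDeltaSqPos` (S-T5) — toolbox 2: exact-ℚ interval arithmetic for the cell checker
(RH-FREE; cell rh-jensen, HUMAN RULING D-0040)

Generic, COMPUTABLE pieces of the kernel certificate that discharges the route's crux `XiDeltaSqPos` zero-free
(Csordas–Varga 1988, Theorem 2.2: `log Φ(√t)` is strictly concave; here: the monotonicity of `−Φ′(u)/(uΦ(u))` on
`(0, 1/4]`, proved by a cell-by-cell interval computation evaluated by `decide` in the kernel). Everything lives on the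
route's existing interval vocabulary (`CoeffTable.Iv`, `Mem`, outward rounding `floorG`/`ceilG` to the grid `10⁻⁶⁴`,
file `JensenPolynomialsXiGorttwCoeffSmallTableCheck.lean`), and adds:

* sign-agnostic interval operations `ivAdd`, `ivNeg`, `ivScale`, `ivMul`, `ivWiden` with inclusion lemmas
  (Moore's inclusion monotonicity);
* polynomials as coefficient lists `List ℚ` (low degree first): evaluation `pevalR`/`pevalQ`, the exact TAYLOR SHIFT
  `taylorShift a p` (coefficients of `p(a + t)`, `pevalR_taylorShift`) and the termwise RANGE `prange h p` of `p(t)` over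
  `t ∈ [0, h]` (`mem_prange`: `q₀ + Σ_{k≥1} min(q_k h^k, 0) ≤ p(t) ≤ q₀ + Σ_{k≥1} max(q_k h^k, 0)`);
* certified exponentials: `expNegSmall s` ∋ `e^{−s}` for `0 ≤ s ≤ 1` (degree-14 Taylor polynomial ± the remainder of
  Mathlib's `Real.exp_bound`), `expNegIv x` ∋ `e^{−x}` for `x ≥ 0` (`e^{−x} = (e^{−1})^{⌊x⌋} e^{−{x}}`), `ivPow`, and
  `expPosHi s ≥ e^{s}` (`0 ≤ s ≤ 1`);
* `covers cells lo hi`: a list of consecutive cells `[a, a + h]` covers `[lo, hi]` (`mem_cell_of_covers`).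

All statements are about arbitrary reals enclosed by the computed rational data; nothing here mentions `Φ` or `ξ`.
WHAT THIS IS NOT: nothing here bears on the zeros of `ζ`. References: R. E. Moore, *Methods and Applications of
Interval Analysis* (1979), Ch. 3 [Moore1979]; Csordas–Varga, Constr. Approx. 4 (1988), Thm 2.2 [CsordasVarga1988].
-/

-- D-0017: `Summit.RiemannHypothesis.RiemannHypothesis.…` duplicates the namespace BY DESIGN (single-problem summit).
set_option linter.dupNamespace false

namespace Summit.RiemannHypothesis.RiemannHypothesis.Theorems.JensenPolynomials.CoeffTable

open Finset
open scoped BigOperators Nat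

/-! ## 1. Sign-agnostic interval operations -/

/-- Sum of intervals (exact). -/
def ivAdd (A B : Iv) : Iv := (A.1 + B.1, A.2 + B.2)
/-- Negation of an interval (exact). -/
def ivNeg (A : Iv) : Iv := (-A.2, -A.1)
/-- Scaling of an interval by a rational constant (exact). -/
def ivScale (c : ℚ) (A : Iv) : Iv := if 0 ≤ c then (c * A.1, c * A.2) else (c * A.2, c * A.1)
/-- Product of two arbitrary intervals: min/max of the four endpoint products, rounded outward. -/
def ivMul (A B : Iv) : Iv :=
  (floorG (min (min (A.1 * B.1) (A.1 * B.2)) (min (A.2 * B.1) (A.2 * B.2))),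
   ceilG (max (max (A.1 * B.1) (A.1 * B.2)) (max (A.2 * B.1) (A.2 * B.2))))
/-- Widening of an interval by `r` on both sides (exact). -/
def ivWiden (A : Iv) (r : ℚ) : Iv := (A.1 - r, A.2 + r)

/-- `ivAdd` encloses sums. -/
theorem mem_ivAdd {A B : Iv} {x y : ℝ} (hx : Mem x A) (hy : Mem y B) : Mem (x + y) (ivAdd A B) := by
  obtain ⟨h1, h2⟩ := hx; obtain ⟨h3, h4⟩ := hy
  unfold ivAdd; constructor <;> push_cast <;> linarith

/-- `ivNeg` encloses negations. -/
theorem mem_ivNeg {A : Iv} {x : ℝ} (hx : Mem x A) : Mem (-x) (ivNeg A) := by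
  obtain ⟨h1, h2⟩ := hx
  unfold ivNeg; constructor <;> push_cast <;> linarith

/-- `ivScale` encloses rational multiples. -/
theorem mem_ivScale (c : ℚ) {A : Iv} {x : ℝ} (hx : Mem x A) : Mem ((c : ℝ) * x) (ivScale c A) := by
  obtain ⟨h1, h2⟩ := hx
  unfold ivScale
  split_ifs with hc
  · have hc' : (0 : ℝ) ≤ (c : ℝ) := by exact_mod_cast hc
    constructor <;> push_cast
    · exact mul_le_mul_of_nonneg_left h1 hc'
    · exact mul_le_mul_of_nonneg_left h2 hc'
  · have hc' : (c : ℝ) ≤ 0 := by exact_mod_cast (not_le.mp hc).le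
    constructor <;> push_cast
    · exact mul_le_mul_of_nonpos_left h2 hc'
    · exact mul_le_mul_of_nonpos_left h1 hc'

/-- `ivWiden A r` encloses `x + e` for `x ∈ A`, `|e| ≤ r`. -/
theorem mem_ivWiden {A : Iv} {r : ℚ} {x e : ℝ} (hx : Mem x A) (he : |e| ≤ (r : ℝ)) : Mem (x + e) (ivWiden A r) := by
  obtain ⟨h1, h2⟩ := hx
  have h3 := (abs_le.mp he).1
  have h4 := (abs_le.mp he).2
  unfold ivWiden; constructor <;> push_cast <;> linarith

/-- The four-corner lower bound for a product of enclosed reals. -/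
theorem min_corners_le_mul {a1 a2 b1 b2 x y : ℝ} (h1 : a1 ≤ x) (h2 : x ≤ a2) (h3 : b1 ≤ y) (h4 : y ≤ b2) :
    min (min (a1 * b1) (a1 * b2)) (min (a2 * b1) (a2 * b2)) ≤ x * y := by
  rcases le_total 0 y with hy | hy
  · have hxy : a1 * y ≤ x * y := mul_le_mul_of_nonneg_right h1 hy
    rcases le_total 0 a1 with ha | ha
    · have : a1 * b1 ≤ a1 * y := mul_le_mul_of_nonneg_left h3 ha
      have := min_le_left (min (a1 * b1) (a1 * b2)) (min (a2 * b1) (a2 * b2))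
      have := min_le_left (a1 * b1) (a1 * b2)
      linarith
    · have : a1 * b2 ≤ a1 * y := mul_le_mul_of_nonpos_left h4 ha
      have := min_le_left (min (a1 * b1) (a1 * b2)) (min (a2 * b1) (a2 * b2))
      have := min_le_right (a1 * b1) (a1 * b2)
      linarith
  · have hxy : a2 * y ≤ x * y := mul_le_mul_of_nonpos_right h2 hy
    rcases le_total 0 a2 with ha | ha
    · have : a2 * b1 ≤ a2 * y := mul_le_mul_of_nonneg_left h3 ha
      have := min_le_right (min (a1 * b1) (a1 * b2)) (min (a2 * b1) (a2 * b2))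
      have := min_le_left (a2 * b1) (a2 * b2)
      linarith
    · have : a2 * b2 ≤ a2 * y := mul_le_mul_of_nonpos_left h4 ha
      have := min_le_right (min (a1 * b1) (a1 * b2)) (min (a2 * b1) (a2 * b2))
      have := min_le_right (a2 * b1) (a2 * b2)
      linarith

/-- The four-corner upper bound for a product of enclosed reals. -/
theorem mul_le_max_corners {a1 a2 b1 b2 x y : ℝ} (h1 : a1 ≤ x) (h2 : x ≤ a2) (h3 : b1 ≤ y) (h4 : y ≤ b2) :
    x * y ≤ max (max (a1 * b1) (a1 * b2)) (max (a2 * b1) (a2 * b2)) := by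
  rcases le_total 0 y with hy | hy
  · have hxy : x * y ≤ a2 * y := mul_le_mul_of_nonneg_right h2 hy
    rcases le_total 0 a2 with ha | ha
    · have : a2 * y ≤ a2 * b2 := mul_le_mul_of_nonneg_left h4 ha
      have := le_max_right (max (a1 * b1) (a1 * b2)) (max (a2 * b1) (a2 * b2))
      have := le_max_right (a2 * b1) (a2 * b2)
      linarith
    · have : a2 * y ≤ a2 * b1 := mul_le_mul_of_nonpos_left h3 ha
      have := le_max_right (max (a1 * b1) (a1 * b2)) (max (a2 * b1) (a2 * b2))
      have := le_max_left (a2 * b1) (a2 * b2)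
      linarith
  · have hxy : x * y ≤ a1 * y := mul_le_mul_of_nonpos_right h1 hy
    rcases le_total 0 a1 with ha | ha
    · have : a1 * y ≤ a1 * b2 := mul_le_mul_of_nonneg_left h4 ha
      have := le_max_left (max (a1 * b1) (a1 * b2)) (max (a2 * b1) (a2 * b2))
      have := le_max_right (a1 * b1) (a1 * b2)
      linarith
    · have : a1 * y ≤ a1 * b1 := mul_le_mul_of_nonpos_left h3 ha
      have := le_max_left (max (a1 * b1) (a1 * b2)) (max (a2 * b1) (a2 * b2))
      have := le_max_left (a1 * b1) (a1 * b2)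
      linarith

/-- `ivMul` encloses products of arbitrary enclosed reals [Moore1979, Ch. 3]. -/
theorem mem_ivMul {A B : Iv} {x y : ℝ} (hx : Mem x A) (hy : Mem y B) : Mem (x * y) (ivMul A B) := by
  obtain ⟨h1, h2⟩ := hx; obtain ⟨h3, h4⟩ := hy
  unfold ivMul
  constructor
  · apply floorG_le_real; push_cast; exact min_corners_le_mul h1 h2 h3 h4
  · apply real_le_ceilG; push_cast; exact mul_le_max_corners h1 h2 h3 h4

/-- A positive lower end certifies positivity of every enclosed real. -/
theorem pos_of_mem {A : Iv} {x : ℝ} (hx : Mem x A) (h : 0 < A.1) : 0 < x :=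
  lt_of_lt_of_le (by exact_mod_cast h) hx.1

/-! ## 2. Polynomials as coefficient lists: evaluation, Taylor shift, range on `[0, h]` -/

/-- Evaluation of a coefficient list (low degree first) at a real point: `[c₀, c₁, …] ↦ c₀ + x(c₁ + x(⋯))`. -/
def pevalR : List ℚ → ℝ → ℝ
  | [], _ => 0
  | c :: cs, x => (c : ℝ) + x * pevalR cs x

/-- Evaluation of a coefficient list at a rational point. -/
def pevalQ : List ℚ → ℚ → ℚ
  | [], _ => 0
  | c :: cs, x => c + x * pevalQ cs x

/-- `pevalR` at a rational point is the cast of `pevalQ`. -/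
theorem pevalR_ratCast (cs : List ℚ) (q : ℚ) : pevalR cs (q : ℝ) = ((pevalQ cs q : ℚ) : ℝ) := by
  induction cs with
  | nil => simp [pevalR, pevalQ]
  | cons c cs ih => simp only [pevalR, pevalQ, ih]; push_cast; ring

/-- Auxiliary for the product by `(a + t)`: carries the previous coefficient. -/
def mulLinAux (a : ℚ) : ℚ → List ℚ → List ℚ
  | prev, [] => [prev]
  | prev, c :: cs => (a * c + prev) :: mulLinAux a c cs

/-- Coefficients of `(a + t)·q(t)`. -/
def mulLin (a : ℚ) : List ℚ → List ℚ
  | [] => []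
  | c :: cs => (a * c) :: mulLinAux a c cs

/-- Semantics of `mulLinAux`. -/
theorem pevalR_mulLinAux (a : ℚ) (t : ℝ) (cs : List ℚ) (prev : ℚ) :
    pevalR (mulLinAux a prev cs) t = (prev : ℝ) + ((a : ℝ) + t) * pevalR cs t := by
  induction cs generalizing prev with
  | nil => simp [mulLinAux, pevalR]
  | cons c cs ih => simp only [mulLinAux, pevalR, ih]; push_cast; ring

/-- `mulLin a q` evaluates to `(a + t)·q(t)`. -/
theorem pevalR_mulLin (a : ℚ) (t : ℝ) (cs : List ℚ) :
    pevalR (mulLin a cs) t = ((a : ℝ) + t) * pevalR cs t := by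
  cases cs with
  | nil => simp [mulLin, pevalR]
  | cons c cs => simp only [mulLin, pevalR, pevalR_mulLinAux]; push_cast; ring

/-- The exact Taylor shift: coefficients of `p(a + t)` as a polynomial in `t`. -/
def taylorShift (a : ℚ) : List ℚ → List ℚ
  | [] => []
  | c :: cs =>
    match mulLin a (taylorShift a cs) with
    | [] => [c]
    | d :: ds => (c + d) :: ds

/-- `taylorShift a p` evaluates at `t` to `p(a + t)`. -/
theorem pevalR_taylorShift (a : ℚ) (t : ℝ) (cs : List ℚ) :
    pevalR (taylorShift a cs) t = pevalR cs ((a : ℝ) + t) := by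
  induction cs with
  | nil => simp [taylorShift, pevalR]
  | cons c cs ih =>
    have hm := pevalR_mulLin a t (taylorShift a cs)
    rw [ih] at hm
    simp only [taylorShift, pevalR]
    rcases hq : mulLin a (taylorShift a cs) with _ | ⟨d, ds⟩
    · rw [hq] at hm; simp only [pevalR] at hm ⊢; linarith
    · rw [hq] at hm; simp only [pevalR] at hm ⊢; push_cast; linarith

/-- Range of the tail `Σ_{j} c_j t^{j+k}` for `t ∈ [0, h]`, given `hk = h^k`: termwise `min(c h^k, 0)` / `max(c h^k, 0)`. -/
def prangeTail (h : ℚ) : ℚ → List ℚ → Iv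
  | _, [] => (0, 0)
  | hk, c :: cs =>
    let r := prangeTail h (hk * h) cs
    (min (c * hk) 0 + r.1, max (c * hk) 0 + r.2)

/-- Range of `p(t)` over `t ∈ [0, h]`: `p₀ + [tail range]`. -/
def prange (h : ℚ) : List ℚ → Iv
  | [] => (0, 0)
  | c :: cs => let r := prangeTail h h cs; (c + r.1, c + r.2)

/-- Soundness of `prangeTail`: `t^{k+1}·q(t)` lies in `prangeTail h (h^{k+1}) q` for `0 ≤ t ≤ h`. -/
theorem mem_prangeTail {h : ℚ} {t : ℝ} (ht0 : 0 ≤ t) (hth : t ≤ (h : ℝ)) (cs : List ℚ) (k : ℕ) :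
    Mem (t ^ (k + 1) * pevalR cs t) (prangeTail h (h ^ (k + 1)) cs) := by
  induction cs generalizing k with
  | nil => simp only [prangeTail, pevalR, mul_zero]; exact ⟨by push_cast; exact le_rfl, by exact_mod_cast le_rfl⟩
  | cons c cs ih =>
    have hpow0 : 0 ≤ t ^ (k + 1) := pow_nonneg ht0 _
    have hpowh : t ^ (k + 1) ≤ (h : ℝ) ^ (k + 1) := pow_le_pow_left₀ ht0 hth _
    have ih' := ih (k + 1)
    rw [show (h : ℚ) ^ (k + 1 + 1) = h ^ (k + 1) * h by ring] at ih'
    obtain ⟨ih1, ih2⟩ := ih'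
    have e : t ^ (k + 1) * pevalR (c :: cs) t = (c : ℝ) * t ^ (k + 1) + t ^ (k + 1 + 1) * pevalR cs t := by
      simp only [pevalR]; ring
    simp only [prangeTail]
    rw [e]
    constructor
    · push_cast
      have hterm : min ((c : ℝ) * (h : ℝ) ^ (k + 1)) 0 ≤ (c : ℝ) * t ^ (k + 1) := by
        rcases le_total 0 (c : ℝ) with hc | hc
        · exact le_trans (min_le_right _ _) (mul_nonneg hc hpow0)
        · exact le_trans (min_le_left _ _) (mul_le_mul_of_nonpos_left hpowh hc)
      linarith
    · push_cast
      have hterm : (c : ℝ) * t ^ (k + 1) ≤ max ((c : ℝ) * (h : ℝ) ^ (k + 1)) 0 := by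
        rcases le_total 0 (c : ℝ) with hc | hc
        · exact le_trans (mul_le_mul_of_nonneg_left hpowh hc) (le_max_left _ _)
        · exact le_trans (mul_nonpos_of_nonpos_of_nonneg hc hpow0) (le_max_right _ _)
      linarith

/-- Soundness of `prange`: `p(t) ∈ prange h p` for `0 ≤ t ≤ h`. -/
theorem mem_prange {h : ℚ} {t : ℝ} (ht0 : 0 ≤ t) (hth : t ≤ (h : ℝ)) (cs : List ℚ) :
    Mem (pevalR cs t) (prange h cs) := by
  cases cs with
  | nil => simp only [prange, pevalR]; exact ⟨by push_cast; exact le_rfl, by push_cast; exact le_rfl⟩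
  | cons c cs =>
    have h1 := mem_prangeTail ht0 hth cs 0
    rw [zero_add, pow_one, pow_one] at h1
    obtain ⟨h1, h2⟩ := h1
    simp only [prange, pevalR]
    constructor <;> push_cast at h1 h2 ⊢ <;> linarith

/-- Range of `p(y)` for `y ∈ [a, a + h]` (Taylor shift, then termwise range). -/
def prangeAt (p : List ℚ) (a h : ℚ) : Iv := prange h (taylorShift a p)

/-- Soundness of `prangeAt`. -/
theorem mem_prangeAt (p : List ℚ) {a h : ℚ} {y : ℝ} (h1 : (a : ℝ) ≤ y) (h2 : y ≤ (a : ℝ) + h) :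
    Mem (pevalR p y) (prangeAt p a h) := by
  have e : y = (a : ℝ) + (y - a) := by ring
  rw [e, ← pevalR_taylorShift]
  exact mem_prange (by linarith) (by linarith) _

/-! ## 3. Certified exponentials -/

/-- Degree-`14` Taylor data for `e^{−s}`, `0 ≤ s ≤ 1`: partial sum and remainder bound of `Real.exp_bound`. -/
def expNegSmall (s : ℚ) : Iv :=
  let T : ℚ := ∑ i ∈ range 14, (-s) ^ i / (i ! : ℚ)
  let err : ℚ := s ^ 14 * (15 / ((14 ! : ℚ) * 14))
  (floorG (T - err), ceilG (T + err))

/-- `e^{−s} ∈ expNegSmall s` for `0 ≤ s ≤ 1`. -/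
theorem mem_expNegSmall {s : ℚ} (hs0 : 0 ≤ s) (hs1 : s ≤ 1) : Mem (Real.exp (-(s : ℝ))) (expNegSmall s) := by
  have hx : |(-(s : ℝ))| ≤ 1 := by
    rw [abs_neg, abs_of_nonneg (by exact_mod_cast hs0)]; exact_mod_cast hs1
  have hb := Real.exp_bound hx (n := 14) (by norm_num)
  rw [abs_neg, abs_of_nonneg (show (0 : ℝ) ≤ s by exact_mod_cast hs0)] at hb
  have h1 := (abs_sub_le_iff.1 hb).1
  have h2 := (abs_sub_le_iff.1 hb).2
  unfold expNegSmall
  constructor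
  · apply floorG_le_real; push_cast at h1 h2 ⊢; linarith
  · apply real_le_ceilG; push_cast at h1 h2 ⊢; linarith

/-- Upper bound `e^{s} ≤ expPosHi s` for `0 ≤ s ≤ 1` (Taylor sum plus remainder). -/
def expPosHi (s : ℚ) : ℚ := (∑ i ∈ range 14, s ^ i / (i ! : ℚ)) + s ^ 14 * 15 / ((14 ! : ℚ) * 14)

/-- `e^{s} ≤ expPosHi s` for `0 ≤ s ≤ 1`. -/
theorem exp_le_expPosHi {s : ℚ} (hs0 : 0 ≤ s) (hs1 : s ≤ 1) : Real.exp (s : ℝ) ≤ (expPosHi s : ℝ) := by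
  have h := Real.exp_bound' (x := (s : ℝ)) (by exact_mod_cast hs0) (by exact_mod_cast hs1) (n := 14) (by norm_num)
  unfold expPosHi
  push_cast at h ⊢
  convert h using 2
  norm_num

/-- Interval power by repeated `ivMul`. -/
def ivPow (A : Iv) : ℕ → Iv
  | 0 => (1, 1)
  | n + 1 => ivMul (ivPow A n) A

/-- `ivPow` encloses powers. -/
theorem mem_ivPow {A : Iv} {x : ℝ} (hx : Mem x A) (n : ℕ) : Mem (x ^ n) (ivPow A n) := by
  induction n with
  | zero => simp only [ivPow, pow_zero]; exact ⟨by push_cast; exact le_rfl, by push_cast; exact le_rfl⟩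
  | succ n ih => rw [pow_succ]; exact mem_ivMul ih hx

/-- Enclosure of `e^{−x}` for rational `x ≥ 0`: `e^{−x} = (e^{−1})^{⌊x⌋} · e^{−(x − ⌊x⌋)}`. -/
def expNegIv (x : ℚ) : Iv :=
  let n : ℕ := ⌊x⌋₊
  ivMul (ivPow (expNegSmall 1) n) (expNegSmall (x - n))

/-- `e^{−x} ∈ expNegIv x` for `x ≥ 0`. -/
theorem mem_expNegIv {x : ℚ} (hx : 0 ≤ x) : Mem (Real.exp (-(x : ℝ))) (expNegIv x) := by
  unfold expNegIv
  set n : ℕ := ⌊x⌋₊ with hn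
  have hfl : (n : ℚ) ≤ x := Nat.floor_le hx
  have hlt : x < (n : ℚ) + 1 := Nat.lt_floor_add_one x
  have e : Real.exp (-(x : ℝ)) = Real.exp (-((1 : ℚ) : ℝ)) ^ n * Real.exp (-((x - n : ℚ) : ℝ)) := by
    rw [← Real.exp_nat_mul, ← Real.exp_add]; congr 1; push_cast; ring
  rw [e]
  exact mem_ivMul (mem_ivPow (mem_expNegSmall zero_le_one le_rfl) n)
    (mem_expNegSmall (by linarith) (by linarith))

/-! ## 4. Covering an interval by consecutive cells -/

/-- `covers cells lo hi`: the cells `[a, a + h]` (in order, each starting at or before the point reached so far)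
jointly cover `[lo, hi]`. -/
def covers : List (ℚ × ℚ) → ℚ → ℚ → Bool
  | [], l, r => decide (r < l)
  | (a, h) :: rest, l, r => decide (a ≤ l) && covers rest (a + h) r

/-- If `covers cells lo hi`, every `y ∈ [lo, hi]` lies in some cell `[a, a + h]` of the list. -/
theorem mem_cell_of_covers {cells : List (ℚ × ℚ)} {lo hi : ℚ} (hc : covers cells lo hi = true) {y : ℝ}
    (h1 : (lo : ℝ) ≤ y) (h2 : y ≤ (hi : ℝ)) : ∃ c ∈ cells, ((c.1 : ℚ) : ℝ) ≤ y ∧ y ≤ ((c.1 : ℚ) : ℝ) + ((c.2 : ℚ) : ℝ) := by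
  induction cells generalizing lo with
  | nil =>
    simp only [covers, decide_eq_true_eq] at hc
    have : ((hi : ℚ) : ℝ) < ((lo : ℚ) : ℝ) := by exact_mod_cast hc
    exfalso; linarith
  | cons c rest ih =>
    obtain ⟨a, h⟩ := c
    simp only [covers, Bool.and_eq_true, decide_eq_true_eq] at hc
    obtain ⟨ha, hrest⟩ := hc
    by_cases hy : y ≤ ((a : ℚ) : ℝ) + ((h : ℚ) : ℝ)
    · exact ⟨(a, h), by simp, by push_cast; exact le_trans (by exact_mod_cast ha) h1, hy⟩
    · obtain ⟨c', hc', hc'1, hc'2⟩ := ih hrest (lo := a + h) (by push_cast; linarith [not_le.mp hy])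
      exact ⟨c', by simp [hc'], hc'1, hc'2⟩

end Summit.RiemannHypothesis.RiemannHypothesis.Theorems.JensenPolynomials.CoeffTable
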